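import Mathlib

/-!
# Fermat CM types on ℚ(ζ_m): kernel-checked finite computations

Certificates for the computations cited in `proofs/p6-weil-classes.md` §5.2–§5.3 (cell pub-hodge-repro0, seat p6).

Conventions. The embeddings of ℚ(ζ_m) are identified with the units `t ∈ (ℤ/m)^×`, represented by the natural numbers
`1 ≤ t < m` coprime to `m`; complex conjugation is `t ↦ m − t`. A *CM type* is a set of units containing exactly one of
`t`, `m − t`. The *Fermat type* attached to `(a, b)` with `a, b, a+b ≢ 0 (mod m)` is
`Φ_{a,b} = {t : (t·a mod m) + (t·b mod m) < m}` — the CM type of the admissible factor `A_S` of the Jacobian of the Fermat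
curve `x^m + y^m + z^m = 0` attached to the orbit `S ∋ (a, b, −a−b)` (Shioda 1981, Def. 2.1; Gordon 1997, 4.3).
Sets of units are represented as sublists of the increasing list `unitsL m`, so that equality of sets is equality of lists.

Results (all by `decide`, i.e. kernel evaluation):
* `coverage_all`: for `m ∈ {3,4,5,6,7,8,9,10,12,14,15,16,18,20}` every CM type on `(ℤ/m)^×` is a Fermat type;
* `not_coverage_11`, `not_coverage_13`: for `m = 11, 13` some CM type is not a Fermat type;
* `example11` / `example13`: the families of four Fermat types quoted in §5.2 are balanced (every unit covered exactly twice),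
  not pair-decomposable (no member is the complement of another), and have trivial right-translation stabiliser
  (orbit size `m − 1`).
-/

namespace HodgeRepro0.Fermat

/-- The units of `ℤ/m` as an increasing list of representatives in `[1, m)`. -/
def unitsL (m : ℕ) : List ℕ := (List.range m).filter (fun t => t != 0 && Nat.gcd t m == 1)

/-- The Fermat type `Φ_{a,b}` as a sublist of `unitsL m`. -/
def fermatL (m a b : ℕ) : List ℕ := (unitsL m).filter (fun t => (t * a) % m + (t * b) % m < m)

/-- All sublists of a list (as lists, preserving order). -/
def sublists : List ℕ → List (List ℕ)
  | [] => [[]]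
  | x :: xs => let r := sublists xs; r ++ r.map (x :: ·)

/-- `T` (a sublist of `unitsL m`) is a CM type: for every unit `t` exactly one of `t`, `m - t` lies in `T`. -/
def isCM (m : ℕ) (T : List ℕ) : Bool := (unitsL m).all (fun t => (T.contains t) != (T.contains (m - t)))

/-- All CM types on `(ℤ/m)^×`, as sublists of `unitsL m`. -/
def cmTypesL (m : ℕ) : List (List ℕ) := (sublists (unitsL m)).filter (isCM m)

/-- All Fermat types `Φ_{a,b}`, `1 ≤ a, b < m`, `a + b ≢ 0 (mod m)`. -/
def fermatTypesL (m : ℕ) : List (List ℕ) :=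
  (List.range m).flatMap fun a =>
    (List.range m).filterMap fun b =>
      if a != 0 && b != 0 && (a + b) % m != 0 then some (fermatL m a b) else none

/-- Every CM type is a Fermat type. -/
def coverage (m : ℕ) : Bool := (cmTypesL m).all (fun T => (fermatTypesL m).contains T)

/-- Every CM type on `(ℤ/3)^×` is a Fermat type. -/
theorem coverage_3 : coverage 3 = true := by decide
/-- Every CM type on `(ℤ/4)^×` is a Fermat type. -/
theorem coverage_4 : coverage 4 = true := by decide
/-- Every CM type on `(ℤ/5)^×` is a Fermat type. -/
theorem coverage_5 : coverage 5 = true := by decide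
/-- Every CM type on `(ℤ/6)^×` is a Fermat type. -/
theorem coverage_6 : coverage 6 = true := by decide
/-- Every CM type on `(ℤ/7)^×` is a Fermat type. -/
theorem coverage_7 : coverage 7 = true := by decide
/-- Every CM type on `(ℤ/8)^×` is a Fermat type. -/
theorem coverage_8 : coverage 8 = true := by decide
/-- Every CM type on `(ℤ/9)^×` is a Fermat type. -/
theorem coverage_9 : coverage 9 = true := by decide
/-- Every CM type on `(ℤ/10)^×` is a Fermat type. -/
theorem coverage_10 : coverage 10 = true := by decide
/-- Every CM type on `(ℤ/12)^×` is a Fermat type. -/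
theorem coverage_12 : coverage 12 = true := by decide
/-- Every CM type on `(ℤ/14)^×` is a Fermat type. -/
theorem coverage_14 : coverage 14 = true := by decide
/-- Every CM type on `(ℤ/15)^×` is a Fermat type. -/
theorem coverage_15 : coverage 15 = true := by decide
/-- Every CM type on `(ℤ/16)^×` is a Fermat type. -/
theorem coverage_16 : coverage 16 = true := by decide
/-- Every CM type on `(ℤ/18)^×` is a Fermat type. -/
theorem coverage_18 : coverage 18 = true := by decide
/-- Every CM type on `(ℤ/20)^×` is a Fermat type. -/
theorem coverage_20 : coverage 20 = true := by decide

/-- A CM type on `(ℤ/11)^×` which is not a Fermat type (witness for the count 20 of 32). -/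
theorem not_coverage_11 :
    isCM 11 [1, 2, 3, 5, 7] = true ∧ (fermatTypesL 11).contains [1, 2, 3, 5, 7] = false := by decide

/-- A CM type on `(ℤ/13)^×` which is not a Fermat type (witness for the count 28 of 64). -/
theorem not_coverage_13 :
    isCM 13 [1, 2, 3, 4, 5, 7] = true ∧ (fermatTypesL 13).contains [1, 2, 3, 4, 5, 7] = false := by decide

/-- Number of times the unit `t` is covered by the family `F`. -/
def cover (F : List (List ℕ)) (t : ℕ) : ℕ := (F.filter (fun T => T.contains t)).length

/-- The family `F` of CM types is balanced with weight `p`. -/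
def balanced (m p : ℕ) (F : List (List ℕ)) : Bool := (unitsL m).all (fun t => cover F t == p)

/-- Complement of `T` inside the units. -/
def compl (m : ℕ) (T : List ℕ) : List ℕ := (unitsL m).filter (fun t => !(T.contains t))

/-- No member of `F` is the complement of another member (so a family of 4 is not pair-decomposable). -/
def noComplementaryPair (m : ℕ) (F : List (List ℕ)) : Bool := F.all (fun T => !(F.contains (compl m T)))

/-- Right translate `T·g = {t·g mod m}` as a sublist of `unitsL m`. -/
def translate (m : ℕ) (T : List ℕ) (g : ℕ) : List ℕ :=
  (unitsL m).filter (fun s => T.any (fun t => (t * g) % m == s))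

/-- The units `g` with `F·g = F` as a set of lists (the right stabiliser of the family). -/
def stabiliser (m : ℕ) (F : List (List ℕ)) : List ℕ :=
  (unitsL m).filter (fun g => (F.map (fun T => translate m T g)).all (fun T => F.contains T))

/-- §5.2, m = 11: the four Fermat types Φ_{1,1}, Φ_{2,3}, Φ_{4,8}, Φ_{5,7}. -/
def fam11 : List (List ℕ) := [fermatL 11 1 1, fermatL 11 2 3, fermatL 11 4 8, fermatL 11 5 7]

/-- The m = 11 family is made of the four quoted types, all CM, balanced with weight 2, has no complementary pair, and has
trivial right stabiliser (orbit size 10). -/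
theorem example11 :
    fam11 = [[1, 2, 3, 4, 5], [1, 2, 4, 6, 8], [3, 6, 7, 9, 10], [5, 7, 8, 9, 10]] ∧
    fam11.all (isCM 11) = true ∧ balanced 11 2 fam11 = true ∧ noComplementaryPair 11 fam11 = true ∧
    stabiliser 11 fam11 = [1] := by decide

/-- §5.2, m = 13, orbit size 4: Φ_{1,5}, Φ_{2,3}, Φ_{6,9}, Φ_{4,10}; stabiliser `{1, 3, 9}` of order 3. -/
def fam13a : List (List ℕ) := [fermatL 13 1 5, fermatL 13 2 3, fermatL 13 6 9, fermatL 13 4 10]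

/-- The first m = 13 family: CM, balanced with weight 2, no complementary pair, stabiliser `{1, 3, 9}` (orbit size 4). -/
theorem example13a :
    fam13a.all (isCM 13) = true ∧ balanced 13 2 fam13a = true ∧ noComplementaryPair 13 fam13a = true ∧
    stabiliser 13 fam13a = [1, 3, 9] := by decide

/-- §5.2, m = 13, orbit size 12: Φ_{1,1}, Φ_{2,2}, Φ_{4,10}, Φ_{3,11}; trivial stabiliser. -/
def fam13b : List (List ℕ) := [fermatL 13 1 1, fermatL 13 2 2, fermatL 13 4 10, fermatL 13 3 11]

/-- The second m = 13 family: CM, balanced with weight 2, no complementary pair, trivial stabiliser (orbit size 12). -/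
theorem example13b :
    fam13b.all (isCM 13) = true ∧ balanced 13 2 fam13b = true ∧ noComplementaryPair 13 fam13b = true ∧
    stabiliser 13 fam13b = [1] := by decide

/-- §6.8, m = 7: the family {1,3,5}, {2,3,6}, {4,5,6}, {1,2,4} is balanced, not pair-decomposable, and its stabiliser is
the subgroup `{1, 2, 4}` of quadratic residues (so the orbit has size 2 and the minimal field is ℚ(√−7)). -/
theorem example7 :
    [[1, 3, 5], [2, 3, 6], [4, 5, 6], [1, 2, 4]].all (isCM 7) = true ∧
    balanced 7 2 [[1, 3, 5], [2, 3, 6], [4, 5, 6], [1, 2, 4]] = true ∧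
    noComplementaryPair 7 [[1, 3, 5], [2, 3, 6], [4, 5, 6], [1, 2, 4]] = true ∧
    stabiliser 7 [[1, 3, 5], [2, 3, 6], [4, 5, 6], [1, 2, 4]] = [1, 2, 4] := by decide

end HodgeRepro0.Fermat
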